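import Literature.NumberTheory.GaloisRepresentations.UnramifiedCompletion
import Literature.NumberTheory.GaloisRepresentations.PAdicHodge
import HarnessLib

/-!
# The period ring `F̂_nr` of a local field as a `PeriodRingData`: `(F̂_nr)^{Gal(F̄/F)} = F`

Let `F` be a non-archimedean local field and `𝒪̂_{F_nr} = maxUnramifiedCompletion F` the complete
discrete valuation ring of integers of the completion of the maximal unramified extension of `F`
(file `UnramifiedCompletion`; uniformiser `ϖ_F`, residue field `k̄`, Galois action `galAut`
with `(𝒪̂_{F_nr})^{Gal} = 𝒪_F`).  This file constructs

* `unramifiedPeriodField F = F̂_nr = Frac 𝒪̂_{F_nr}` (a `def`-wrapped `FractionRing`, so that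
  only the instances declared here are seen by instance search) with its field structure, the
  action of `Gal(F̄/F)` by field automorphisms (`galAut`, Mathlib
  `IsFractionRing.ringEquivOfRingEquivHom`), the `F`-algebra structure
  (`IsFractionRing.lift` of `𝒪_F → 𝒪̂_{F_nr} → F̂_nr`) commuting with the action;
* **`(F̂_nr)^{Gal(F̄/F)} = F`** (`mem_range_algebraMap_of_forall_smul_eq`): write an invariant
  `b = x / ϖ^m` with `x ∈ 𝒪̂_{F_nr}` invariant and use `(𝒪̂_{F_nr})^{Gal} = 𝒪_F`;
* `unramifiedPeriodRingData F p : PeriodRingData (absoluteGaloisGroup F) ℚ_[p] F` — **the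
  period-ring datum `B = F̂_nr` with the trivial filtration** (`Fil^i = B` for `i ≤ 0`, `0` for
  `i > 0`): Fontaine's regularity axioms hold because `B` is a field with `B^{Γ_F} = F`.

`F̂_nr` is the sub-period-ring `(B_dR)^{I_F} ∩ B_cris^{φ = 1}`-flavoured part of Fontaine's rings
seeing exactly the unramified representations: a `p`-adic representation of `Γ_F` is
`F̂_nr`-admissible iff it is unramified (Lang's theorem; files `LangTheorem`,
`UnramifiedAdmissible`), and all its Hodge–Tate weights for this datum are `0`.
Fontaine, *Représentations p-adiques des corps locaux* (1990), A1.2.4–A1.2.6 / Fontaine–Ouyang,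
*Theory of p-adic Galois representations*, Thm. 2.13 & Prop. 2.14 (`K̂^nr`-representations,
`H¹(G_K, GL_n(K̂^nr))` and unramified representations); Serre, *Local Fields*, Ch. XIII §5.

Definitions: `unramifiedPeriodField` (+ instances), `unramifiedPeriodField.galAut`,
`unramifiedPeriodField.fil`, `unramifiedPeriodRingData`. No named facts.

## References

* J.-M. Fontaine, *Représentations p-adiques des corps locaux I*, in: The Grothendieck
  Festschrift II (1990), §A1.2. [FontaineAsterisque223III for the regularity formalism, Exp. III §1.4]
* [SerreLocalFields1979] J.-P. Serre, *Local Fields*, GTM 67, Ch. XIII §5.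
-/

noncomputable section

open ValuativeRel Field IsLocalRing
open scoped Pointwise

namespace Literature.NumberTheory.GaloisRepresentations
namespace IsNonarchimedeanLocalField

universe u

variable (F : Type u) [Field F] [ValuativeRel F] [TopologicalSpace F] [IsNonarchimedeanLocalField F]

/-! ### The field `F̂_nr` -/

/-- **`F̂_nr`**, the completion of the maximal unramified extension of the local field `F`: the
fraction field of `𝒪̂_{F_nr} = maxUnramifiedCompletion F`.  A `def` (not an `abbrev`): the type
carries exactly the instances declared below. Serre, *Local Fields*, Ch. II §5; Fontaine 1990,
A1.2. [cite: SerreLocalFields1979, Ch. II §5] -/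
def unramifiedPeriodField : Type u :=
  FractionRing (maxUnramifiedCompletion F)

namespace unramifiedPeriodField

/-- `F̂_nr` is a field. [folklore] -/
instance instField : Field (unramifiedPeriodField F) :=
  inferInstanceAs (Field (FractionRing (maxUnramifiedCompletion F)))

/-- `F̂_nr` is an `𝒪̂_{F_nr}`-algebra. [folklore] -/
instance instAlgebraCompletion : Algebra (maxUnramifiedCompletion F) (unramifiedPeriodField F) :=
  inferInstanceAs (Algebra (maxUnramifiedCompletion F) (FractionRing (maxUnramifiedCompletion F)))

/-- `F̂_nr` is the fraction field of `𝒪̂_{F_nr}`. [folklore] -/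
instance instIsFractionRing : IsFractionRing (maxUnramifiedCompletion F) (unramifiedPeriodField F) :=
  inferInstanceAs (IsFractionRing (maxUnramifiedCompletion F) (FractionRing (maxUnramifiedCompletion F)))

/-- The action of `Gal(F̄/F)` on `F̂_nr` by field automorphisms, extending `galAut` on `𝒪̂_{F_nr}`
to the fraction field (Mathlib `IsFractionRing.ringEquivOfRingEquivHom`).
[cite: SerreLocalFields1979, Ch. II §5] -/
def galAut : absoluteGaloisGroup F →* (unramifiedPeriodField F ≃+* unramifiedPeriodField F) :=
  (IsFractionRing.ringEquivOfRingEquivHom (maxUnramifiedCompletion F) (unramifiedPeriodField F)).comp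
    (maxUnramifiedCompletion.galAut F)

/-- `Gal(F̄/F)` acts on `F̂_nr` by field automorphisms. [cite: SerreLocalFields1979, Ch. II §5] -/
instance instMulSemiringAction : MulSemiringAction (absoluteGaloisGroup F) (unramifiedPeriodField F) :=
  MulSemiringAction.compHom _ (galAut F)

variable {F}

/-- Unfolding lemma: `σ • b = galAut σ b`. [folklore] -/
theorem smul_def (σ : absoluteGaloisGroup F) (b : unramifiedPeriodField F) : σ • b = galAut F σ b := rfl

/-- **The action extends that on `𝒪̂_{F_nr}`.** [folklore] -/
@[simp] theorem smul_algebraMap (σ : absoluteGaloisGroup F) (x : maxUnramifiedCompletion F) :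
    σ • algebraMap (maxUnramifiedCompletion F) (unramifiedPeriodField F) x =
      algebraMap (maxUnramifiedCompletion F) (unramifiedPeriodField F)
        (maxUnramifiedCompletion.galAut F σ x) := by
  rw [smul_def, galAut, MonoidHom.comp_apply, IsFractionRing.ringEquivOfRingEquivHom_apply,
    IsFractionRing.ringEquivOfRingEquiv_algebraMap]

/-- `σ • (x / y) = σ x / σ y`. [folklore] -/
theorem smul_div (σ : absoluteGaloisGroup F) (x y : unramifiedPeriodField F) :
    σ • (x / y) = σ • x / σ • y := by
  rw [smul_def, smul_def, smul_def, map_div₀]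

variable (F) in
/-- `F̂_nr` as an `𝒪[F]`-algebra, through `𝒪[F] → 𝒪̂_{F_nr} → F̂_nr`. [folklore] -/
instance instAlgebraInteger : Algebra 𝒪[F] (unramifiedPeriodField F) :=
  ((algebraMap (maxUnramifiedCompletion F) (unramifiedPeriodField F)).comp
    (algebraMap 𝒪[F] (maxUnramifiedCompletion F))).toAlgebra

/-- `𝒪[F] → 𝒪̂_{F_nr} → F̂_nr` is a scalar tower (by definition). [folklore] -/
instance instIsScalarTowerInteger :
    IsScalarTower 𝒪[F] (maxUnramifiedCompletion F) (unramifiedPeriodField F) :=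
  IsScalarTower.of_algebraMap_eq fun _ => rfl

/-- `𝒪[F] → 𝒪̂_{F_nr}` is injective. [folklore] -/
theorem algebraMap_integer_completion_injective :
    Function.Injective (algebraMap 𝒪[F] (maxUnramifiedCompletion F)) := by
  intro a b h
  rw [maxUnramifiedCompletion.algebraMap_eq, maxUnramifiedCompletion.algebraMap_eq,
    AdicCompletion.algebraMap_apply, AdicCompletion.algebraMap_apply, Algebra.algebraMap_self,
    RingHom.id_apply, RingHom.id_apply] at h
  exact algebraMap_maxUnramifiedIntegers_injective (AdicCompletion.of_injective _ _ h)

/-- `𝒪[F] → F̂_nr` is injective. [folklore] -/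
theorem algebraMap_integer_injective :
    Function.Injective (algebraMap 𝒪[F] (unramifiedPeriodField F)) :=
  (IsFractionRing.injective (maxUnramifiedCompletion F) (unramifiedPeriodField F)).comp
    algebraMap_integer_completion_injective

variable (F) in
/-- **`F̂_nr` is an extension of `F`**: the `F`-algebra structure extending `𝒪[F] → F̂_nr` to the
fraction field `F` of `𝒪[F]` (Mathlib `IsFractionRing.lift`). [cite: SerreLocalFields1979, Ch. II §5] -/
instance instAlgebra : Algebra F (unramifiedPeriodField F) :=
  (IsFractionRing.lift (K := F) (algebraMap_integer_injective (F := F))).toAlgebra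

/-- Unfolding lemma for the `F`-algebra structure. [folklore] -/
theorem algebraMap_def :
    algebraMap F (unramifiedPeriodField F) =
      IsFractionRing.lift (K := F) (algebraMap_integer_injective (F := F)) := rfl

/-- `𝒪[F] → F → F̂_nr` is a scalar tower. [folklore] -/
instance instIsScalarTowerField : IsScalarTower 𝒪[F] F (unramifiedPeriodField F) :=
  IsScalarTower.of_algebraMap_eq fun a => by
    rw [algebraMap_def, IsFractionRing.lift_algebraMap]

/-- Compatibility of the structure maps: `𝒪[F] → F → F̂_nr` equals `𝒪[F] → 𝒪̂_{F_nr} → F̂_nr`.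
[folklore] -/
theorem algebraMap_coe_integer (a : 𝒪[F]) :
    algebraMap F (unramifiedPeriodField F) (a : F) =
      algebraMap (maxUnramifiedCompletion F) (unramifiedPeriodField F)
        (algebraMap 𝒪[F] (maxUnramifiedCompletion F) a) := by
  rw [show ((a : F) : F) = algebraMap 𝒪[F] F a from rfl,
    ← IsScalarTower.algebraMap_apply 𝒪[F] F (unramifiedPeriodField F),
    IsScalarTower.algebraMap_apply 𝒪[F] (maxUnramifiedCompletion F) (unramifiedPeriodField F)]

/-- **`Gal(F̄/F)` fixes `F ⊆ F̂_nr` pointwise.** [folklore] -/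
@[simp] theorem smul_algebraMap_field (σ : absoluteGaloisGroup F) (a : F) :
    σ • algebraMap F (unramifiedPeriodField F) a = algebraMap F (unramifiedPeriodField F) a := by
  obtain ⟨x, y, hy, rfl⟩ := IsFractionRing.div_surjective (A := 𝒪[F]) a
  rw [map_div₀, smul_div]
  congr 1
  · rw [show ((algebraMap 𝒪[F] F) x : F) = (x : F) from rfl, algebraMap_coe_integer, smul_algebraMap,
      maxUnramifiedCompletion.galAut_algebraMap]
  · rw [show ((algebraMap 𝒪[F] F) y : F) = (y : F) from rfl, algebraMap_coe_integer, smul_algebraMap,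
      maxUnramifiedCompletion.galAut_algebraMap]

/-- The Galois action on `F̂_nr` is `F`-linear. [folklore] -/
instance instSMulCommClass : SMulCommClass (absoluteGaloisGroup F) F (unramifiedPeriodField F) where
  smul_comm σ a b := by
    rw [Algebra.smul_def, Algebra.smul_def, smul_mul', smul_algebraMap_field]

/-! ### `(F̂_nr)^{Gal(F̄/F)} = F` -/

/-- **`(F̂_nr)^{Gal(F̄/F)} = F`**: a Galois-invariant element of `F̂_nr` lies in `F`.  Write
`b = x / ϖ ^ m` with `x ∈ 𝒪̂_{F_nr}` (`𝒪̂_{F_nr}` is a discrete valuation ring with uniformiser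
`ϖ = ϖ_F ∈ F`); then `x` is invariant, hence in `𝒪_F` (`(𝒪̂_{F_nr})^{Gal} = 𝒪_F`,
`maxUnramifiedCompletion.mem_range_algebraMap_of_forall_galAut_eq`). Fontaine 1990, A1.2;
Serre, *Local Fields*, Ch. XIII §5. [cite: SerreLocalFields1979, Ch. IV §4 Cor. 2 to Prop. 16] -/
theorem mem_range_algebraMap_of_forall_smul_eq {b : unramifiedPeriodField F}
    (hb : ∀ σ : absoluteGaloisGroup F, σ • b = b) :
    b ∈ Set.range (algebraMap F (unramifiedPeriodField F)) := by
  obtain ⟨ϖ, hϖ⟩ := IsDiscreteValuationRing.exists_irreducible 𝒪[F]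
  let R := maxUnramifiedCompletion F
  let B := unramifiedPeriodField F
  have hPirr : Irreducible (algebraMap 𝒪[F] R ϖ) :=
    maxUnramifiedCompletion.irreducible_algebraMap_uniformizer hϖ
  -- `b = x / y`, `y = u * ϖ ^ m`
  obtain ⟨x, y, hy, hbxy⟩ := IsFractionRing.div_surjective (A := R) b
  have hy0 : y ≠ 0 := nonZeroDivisors.ne_zero hy
  obtain ⟨m, u, rfl⟩ := IsDiscreteValuationRing.eq_unit_mul_pow_irreducible hy0 hPirr
  have hPB : algebraMap R B (algebraMap 𝒪[F] R ϖ) = algebraMap F B (ϖ : F) :=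
    (algebraMap_coe_integer ϖ).symm
  have hPB0 : algebraMap R B (algebraMap 𝒪[F] R ϖ) ≠ 0 :=
    (map_ne_zero_iff _ (IsFractionRing.injective R B)).2 hPirr.ne_zero
  -- `x' = x * u⁻¹` satisfies `b = x' / ϖ ^ m`
  have hb_eq : b = algebraMap R B (x * ↑u⁻¹) / algebraMap R B (algebraMap 𝒪[F] R ϖ) ^ m := by
    rw [← hbxy, map_mul (algebraMap R B) x, map_units_inv, map_mul (algebraMap R B) ↑u, map_pow,
      div_mul_eq_div_div, div_eq_mul_inv ((algebraMap R B) x)]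
  have hx'inv : ∀ σ : absoluteGaloisGroup F, maxUnramifiedCompletion.galAut F σ (x * ↑u⁻¹) = x * ↑u⁻¹ := by
    intro σ
    have h1 := hb σ
    rw [hb_eq, smul_div, smul_pow', smul_algebraMap, hPB, smul_algebraMap_field, ← hPB] at h1
    have h2 := (div_left_inj' (pow_ne_zero m hPB0)).1 h1
    exact IsFractionRing.injective R B h2
  obtain ⟨c, hc⟩ := maxUnramifiedCompletion.mem_range_algebraMap_of_forall_galAut_eq hx'inv
  refine ⟨(c : F) / (ϖ : F) ^ m, ?_⟩
  rw [hb_eq, map_div₀, map_pow, ← hPB, algebraMap_coe_integer, hc]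

/-- Invariance of quotients: if `σ b * c = b * σ c` for all `σ` (`c ≠ 0`) then `b = e c` with
`e ∈ F` (Fontaine's regularity condition (ii) for the field `F̂_nr`).
[cite: FontaineAsterisque223III, Exp. III §1.4] -/
theorem exists_smul_eq (b c : unramifiedPeriodField F) (hc : c ≠ 0)
    (h : ∀ σ : absoluteGaloisGroup F, σ • b * c = b * σ • c) :
    ∃ e : F, b = e • c := by
  have hinv : ∀ σ : absoluteGaloisGroup F, σ • (b / c) = b / c := by
    intro σ
    have hσc : σ • c ≠ 0 := by
      rw [smul_def]; exact (map_ne_zero_iff _ (galAut F σ).injective).2 hc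
    rw [smul_div, div_eq_div_iff hσc hc]
    exact h σ
  obtain ⟨e, he⟩ := mem_range_algebraMap_of_forall_smul_eq hinv
  refine ⟨e, ?_⟩
  rw [Algebra.smul_def, he, div_mul_cancel₀ _ hc]

/-! ### The trivial filtration -/

variable (F) in
/-- The trivial filtration on `F̂_nr`: `Fil^i = F̂_nr` for `i ≤ 0` and `Fil^i = 0` for `i > 0`
(`F̂_nr ⊆ B_dR^+ = Fil⁰ B_dR` and `F̂_nr ∩ Fil¹ B_dR = 0`; all Hodge–Tate weights of
`F̂_nr`-admissible representations are `0`). [folklore] -/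
def fil (i : ℤ) : Submodule F (unramifiedPeriodField F) :=
  if i ≤ 0 then ⊤ else ⊥

/-- `Fil^i = ⊤` for `i ≤ 0`. [folklore] -/
theorem fil_of_nonpos {i : ℤ} (hi : i ≤ 0) : fil F i = ⊤ := if_pos hi

/-- `Fil^i = ⊥` for `i > 0`. [folklore] -/
theorem fil_of_pos {i : ℤ} (hi : 0 < i) : fil F i = ⊥ := if_neg (not_le.2 hi)

/-- The trivial filtration is decreasing. [folklore] -/
theorem fil_antitone : Antitone (fil F) := by
  intro i j hij
  by_cases hj : j ≤ 0
  · rw [fil_of_nonpos hj, fil_of_nonpos (hij.trans hj)]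
  · rw [fil_of_pos (not_le.1 hj)]
    exact bot_le

end unramifiedPeriodField

/-! ### The period-ring datum -/

open unramifiedPeriodField in
/-- **The period-ring datum `B = F̂_nr`** for `Γ_F = Gal(F̄/F)` over `ℚ_p` with invariants `F`
(`(F̂_nr)^{Γ_F} = F`) and the trivial filtration (`Fil^i = F̂_nr` for `i ≤ 0`, `0` for `i > 0`);
Fontaine's regularity axioms hold since `F̂_nr` is a field.  Its admissible representations are
the unramified ones (Lang's theorem / `H¹(Γ_F, GL_n(F̂_nr)) = 1` on unramified cocycles:
Fontaine 1990, A1.2.6; Fontaine–Ouyang Prop. 2.14), all of Hodge–Tate weight `0`; it is the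
part of Fontaine's `B_dR` fixed by inertia, `(B_dR)^{I_F} = F̂_nr`, with the filtration it
induces on weight-`0` objects.  The `ℚ_p`-algebra structure of `F` is the ambient instance.
[cite: FontaineAsterisque223III, Exp. III §1.4] -/
def unramifiedPeriodRingData (p : ℕ) [Fact p.Prime] [Algebra ℚ_[p] F] :
    PeriodRingData.{u, 0, u, u} (absoluteGaloisGroup F) ℚ_[p] F where
  B := unramifiedPeriodField F
  invariants_eq := by
    ext b
    simp only [Set.mem_setOf_eq, Set.mem_range]
    constructor
    · intro hb
      obtain ⟨e, he⟩ := mem_range_algebraMap_of_forall_smul_eq hb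
      exact ⟨e, he⟩
    · rintro ⟨e, rfl⟩ σ
      exact smul_algebraMap_field σ e
  exists_smul_eq := fun b c hc h => unramifiedPeriodField.exists_smul_eq b c hc h
  isUnit_of_smul_mem := fun b hb _ => isUnit_iff_ne_zero.2 hb
  fil := fil F
  fil_antitone := fil_antitone
  mul_mem_fil := by
    intro i j x y hx hy
    by_cases hij : i + j ≤ 0
    · rw [fil_of_nonpos hij]; exact Submodule.mem_top
    · -- one of `i`, `j` is positive, so `x = 0` or `y = 0`
      by_cases hi : 0 < i
      · rw [fil_of_pos hi, Submodule.mem_bot] at hx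
        rw [hx, zero_mul]; exact zero_mem _
      · have hj : 0 < j := by omega
        rw [fil_of_pos hj, Submodule.mem_bot] at hy
        rw [hy, mul_zero]; exact zero_mem _
  one_mem_fil_zero := by rw [fil_of_nonpos le_rfl]; exact Submodule.mem_top
  smul_mem_fil := by
    intro σ i x hx
    by_cases hi : i ≤ 0
    · rw [fil_of_nonpos hi]; exact Submodule.mem_top
    · rw [fil_of_pos (not_le.1 hi), Submodule.mem_bot] at hx ⊢
      rw [hx, smul_zero]
  iSup_fil := eq_top_iff.2 (le_iSup_of_le 0 (by rw [fil_of_nonpos le_rfl]))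
  iInf_fil := eq_bot_iff.2 (iInf_le_of_le 1 (by rw [fil_of_pos one_pos]))

/-- The period ring of `unramifiedPeriodRingData` is `F̂_nr`. [folklore] -/
@[simp] theorem unramifiedPeriodRingData_B (p : ℕ) [Fact p.Prime] [Algebra ℚ_[p] F] :
    (unramifiedPeriodRingData F p).B = unramifiedPeriodField F := rfl

/-- The filtration of `unramifiedPeriodRingData` is the trivial one. [folklore] -/
@[simp] theorem unramifiedPeriodRingData_fil (p : ℕ) [Fact p.Prime] [Algebra ℚ_[p] F] :
    (unramifiedPeriodRingData F p).fil = unramifiedPeriodField.fil F := rfl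

end IsNonarchimedeanLocalField
end Literature.NumberTheory.GaloisRepresentations

end
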